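import Mathlib
import Summits.MatrixMultiplication.MatrixMultiplication.Theorems.BorderHalfDimensionDesigns.Negative.AffineSubfamilyBounds

/-!
# `GLnSeparatingDesigns.BorderHalfDimensionDesigns` (stmt-MatrixMultiplication-18360) — Negative lane, IV:
# sub-family kills — no half-dimensional border designs with `X` (or `Y`) in an affine subspace of
# dimension `≤ (n²−n)/2` (unitriangular / torus / vector-group / central hosts are dead on arrival)
-/

namespace Summit.MatrixMultiplication.MatrixMultiplication.Theorems

open scoped BigOperators Matrix
open Finset

namespace BorderHalfDimensionDesignsNeg

/-- Real bookkeeping shared by the exponent-form kills: `q^a ≤ N ≤ (s+1)^m`, `s ≤ q^b`, `m ≤ μ`,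
`b μ < a` is impossible for large `q`. [folklore] -/
theorem counting_real_core {a b μ : ℝ} (hb : 0 ≤ b) (hab : b * μ < a) :
    ∃ q₀ : ℕ, ∀ q : ℕ, q₀ ≤ q → ∀ N s m : ℕ, (m : ℝ) ≤ μ → (q : ℝ) ^ a ≤ N → (s : ℝ) ≤ (q : ℝ) ^ b →
      ¬ (N ≤ (s + 1) ^ m) := by
  set γ : ℝ := a - b * μ with hγ
  have hγpos : 0 < γ := by rw [hγ]; linarith
  set B : ℝ := (2 : ℝ) ^ ((μ + 1) / γ) with hB
  refine ⟨⌈B⌉₊ + 2, fun q hq N s m hm hN hs hle => ?_⟩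
  have hqB : B ≤ q := le_trans (Nat.le_ceil B) (by exact_mod_cast (by omega : ⌈B⌉₊ ≤ q))
  have hq2 : (2 : ℝ) ≤ q := by exact_mod_cast (by omega : 2 ≤ q)
  have hq1 : (1 : ℝ) ≤ q := by linarith
  have hq0 : (0 : ℝ) < q := by linarith
  have hqb1 : (1 : ℝ) ≤ (q : ℝ) ^ b := Real.one_le_rpow hq1 hb
  have h1 : (q : ℝ) ^ a ≤ ((s : ℝ) + 1) ^ m := hN.trans (by exact_mod_cast hle)
  have h2 : ((s : ℝ) + 1) ^ m ≤ (2 * (q : ℝ) ^ b) ^ m := pow_le_pow_left₀ (by positivity) (by linarith) _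
  have h3 : (2 * (q : ℝ) ^ b) ^ m ≤ (2 : ℝ) ^ μ * (q : ℝ) ^ (b * μ) := by
    rw [mul_pow, ← Real.rpow_natCast ((q : ℝ) ^ b) m, ← Real.rpow_mul hq0.le,
      ← Real.rpow_natCast (2 : ℝ) m]
    refine mul_le_mul (Real.rpow_le_rpow_of_exponent_le (by norm_num) hm)
      (Real.rpow_le_rpow_of_exponent_le hq1 (mul_le_mul_of_nonneg_left hm hb))
      (by positivity) (by positivity)
  have h4 : (q : ℝ) ^ a = (q : ℝ) ^ γ * (q : ℝ) ^ (b * μ) := by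
    rw [← Real.rpow_add hq0]; congr 1; rw [hγ]; ring
  have h5 : (q : ℝ) ^ γ ≤ (2 : ℝ) ^ μ :=
    le_of_mul_le_mul_right (h4 ▸ (h1.trans (h2.trans h3))) (Real.rpow_pos_of_pos hq0 _)
  have h6 : B ^ γ ≤ (q : ℝ) ^ γ := Real.rpow_le_rpow (by positivity) hqB hγpos.le
  have h7 : B ^ γ = 2 * (2 : ℝ) ^ μ := by
    rw [hB, ← Real.rpow_mul (by norm_num : (0 : ℝ) ≤ 2), div_mul_cancel₀ _ hγpos.ne',
      Real.rpow_add (by norm_num : (0 : ℝ) < 2), Real.rpow_one, mul_comm]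
  have h8 : (0 : ℝ) < (2 : ℝ) ^ μ := by positivity
  linarith

/-- **No half-dimensional border designs with `X` in an affine subspace of dimension `≤ (n²−n)/2`.**
The crux strengthened by "`X ⊆ A₀ + span(A₁,…,A_m)` with `2m + n ≤ n²`" is FALSE — already at
`ε = 1/8`, `δ = 1/(4n)`: `q^(n²/2 − n/8) ≤ |X| ≤ (q^(1+δ) + 1)^((n²−n)/2)` fails for large `q`.
Dead on arrival for this crux: `X` (and likewise `Y`, `Z`) inside a translate `a·L·b` of the
unitriangular group, a maximal torus, a Borel unipotent radical, a block vector group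
`[[I,T],[0,I]]`, or `exp` of an abelian nilpotent Lie algebra (BCGPU's running-example hosts, which sit
exactly at `ε = 1/2`). [folklore] -/
theorem not_borderHalfDimensionDesigns_affineX :
    ¬ (∀ ε : ℝ, 0 < ε → ∃ n : ℕ, 3 ≤ n ∧ ∀ δ : ℝ, 0 < δ → ∀ q₀ : ℕ, ∃ q : ℕ, q₀ ≤ q ∧
        ∀ η : ℝ, 0 < η → ∃ X Y Z : Finset (Matrix.GeneralLinearGroup (Fin n) ℂ), (∀ x ∈ X, ∀ x' ∈ X, ∀ y ∈ Y, ∀ y' ∈ Y, ∀ z ∈ Z, ∀ z' ∈ Z,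
            x * y⁻¹ * y' * z⁻¹ = x' * z'⁻¹ → x = x' ∧ y = y' ∧ z = z') ∧
          (q : ℝ) ^ ((n : ℝ) ^ 2 / 2 - ε * n) ≤ (X.card : ℝ) ∧
          (q : ℝ) ^ ((n : ℝ) ^ 2 / 2 - ε * n) ≤ (Y.card : ℝ) ∧
          (q : ℝ) ^ ((n : ℝ) ^ 2 / 2 - ε * n) ≤ (Z.card : ℝ) ∧
          (∀ x₀ ∈ X, ∀ z₀ ∈ Z, ∃ p : MvPolynomial (Fin n × Fin n) ℂ,
            (p.totalDegree : ℝ) ≤ (q : ℝ) ^ (1 + δ) ∧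
            ∀ x ∈ X, ∀ y ∈ Y, ∀ y' ∈ Y, ∀ z ∈ Z,
              ((x = x₀ ∧ y = y' ∧ z = z₀) → ‖MvPolynomial.eval (pt x y y' z) p - 1‖ ≤ η) ∧
              (¬ (x = x₀ ∧ y = y' ∧ z = z₀) → ‖MvPolynomial.eval (pt x y y' z) p‖ ≤ η)) ∧
          ∃ m : ℕ, 2 * m + n ≤ n ^ 2 ∧
            ∃ (A₀ : Matrix (Fin n) (Fin n) ℂ) (A : Fin m → Matrix (Fin n) (Fin n) ℂ),
              ∀ x ∈ X, ∃ t : Fin m → ℂ, (x : Matrix (Fin n) (Fin n) ℂ) = A₀ + ∑ k, t k • A k) := by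
  intro H
  obtain ⟨n, hn3, Hn⟩ := H (1 / 8) (by norm_num)
  have hn : (3 : ℝ) ≤ n := by exact_mod_cast hn3
  have hnpos : (0 : ℝ) < n := by linarith
  have Hδ := Hn (1 / (4 * n)) (by positivity)
  obtain ⟨q₀, hq₀⟩ := counting_real_core (a := (n : ℝ) ^ 2 / 2 - 1 / 8 * n) (b := 1 + 1 / (4 * n))
    (μ := ((n : ℝ) ^ 2 - n) / 2) (by positivity) (by
      have e : (1 + 1 / (4 * n)) * (((n : ℝ) ^ 2 - n) / 2)
          = ((n : ℝ) ^ 2 - n) / 2 + (n - 1) / 8 := by field_simp; ring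
      rw [e]; nlinarith)
  obtain ⟨q, hq, Hq⟩ := Hδ (max q₀ 1)
  have hq1 : (1 : ℝ) ≤ q := by exact_mod_cast le_trans (le_max_right q₀ 1) hq
  have hq0 : (0 : ℝ) < q := by linarith
  set a : ℝ := (n : ℝ) ^ 2 / 2 - 1 / 8 * n with ha
  set N : ℕ := ⌈(q : ℝ) ^ a⌉₊ with hN
  set s : ℕ := ⌊(q : ℝ) ^ ((1 : ℝ) + 1 / (4 * n))⌋₊ with hs
  have hqa : (0 : ℝ) < (q : ℝ) ^ a := Real.rpow_pos_of_pos hq0 a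
  set η : ℝ := 1 / (2 * ((N : ℝ) + 1)) with hη
  have hηpos : 0 < η := by rw [hη]; positivity
  obtain ⟨X, Y, Z, -, hX, hY, hZ, hsep, m, hm, A₀, A, hXaff⟩ := Hq η hηpos
  have hNX : N ≤ X.card := Nat.ceil_le.mpr hX
  have hYne : Y.Nonempty := by
    rw [← Finset.card_pos]
    have : (0 : ℝ) < Y.card := lt_of_lt_of_le (Real.rpow_pos_of_pos hq0 _) hY
    exact_mod_cast this
  have hZne : Z.Nonempty := by
    rw [← Finset.card_pos]
    have : (0 : ℝ) < Z.card := lt_of_lt_of_le (Real.rpow_pos_of_pos hq0 _) hZ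
    exact_mod_cast this
  obtain ⟨X', hX'X, hX'card⟩ := Finset.exists_subset_card_eq hNX
  have hsep' : ∀ x₀ ∈ X', ∀ z₀ ∈ Z, ∃ p : MvPolynomial (Fin n × Fin n) ℂ, p.totalDegree ≤ s ∧
      ∀ x ∈ X', ∀ y ∈ Y, ∀ y' ∈ Y, ∀ z ∈ Z,
        ((x = x₀ ∧ y = y' ∧ z = z₀) → ‖MvPolynomial.eval (pt x y y' z) p - 1‖ ≤ η) ∧
        (¬ (x = x₀ ∧ y = y' ∧ z = z₀) → ‖MvPolynomial.eval (pt x y y' z) p‖ ≤ η) := by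
    intro x₀ hx₀ z₀ hz₀
    obtain ⟨p, hpdeg, hp⟩ := hsep x₀ (hX'X hx₀) z₀ hz₀
    exact ⟨p, Nat.le_floor hpdeg, fun x hx y hy y' hy' z hz => hp x (hX'X hx) y hy y' hy' z hz⟩
  have hηN : η * X'.card < 1 := by
    rw [hX'card, hη, div_mul_eq_mul_div, one_mul, div_lt_one (by positivity)]
    linarith
  have hbound := card_le_of_separators_affine hYne hZne hsep' hηN A₀ A
    (fun x hx => hXaff x (hX'X hx))
  rw [hX'card] at hbound
  have hmμ : (m : ℝ) ≤ ((n : ℝ) ^ 2 - n) / 2 := by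
    have : ((2 * m + n : ℕ) : ℝ) ≤ ((n ^ 2 : ℕ) : ℝ) := by exact_mod_cast hm
    push_cast at this
    linarith
  exact hq₀ q (le_trans (le_max_left _ _) hq) N s m hmμ (Nat.le_ceil _)
    (Nat.floor_le (by positivity)) hbound


/-- **No half-dimensional border designs with `Y` in an affine subspace of dimension `≤ (n²−n)/2`**
(in particular: `Y` central, `Y` diagonal, `Y` inside a vector group or a translate of the
unitriangular group).  Same counting as `not_borderHalfDimensionDesigns_affineX`, through
`card_Y_le_of_separators_affine`. [folklore] -/
theorem not_borderHalfDimensionDesigns_affineY :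
    ¬ (∀ ε : ℝ, 0 < ε → ∃ n : ℕ, 3 ≤ n ∧ ∀ δ : ℝ, 0 < δ → ∀ q₀ : ℕ, ∃ q : ℕ, q₀ ≤ q ∧
        ∀ η : ℝ, 0 < η → ∃ X Y Z : Finset (Matrix.GeneralLinearGroup (Fin n) ℂ), (∀ x ∈ X, ∀ x' ∈ X, ∀ y ∈ Y, ∀ y' ∈ Y, ∀ z ∈ Z, ∀ z' ∈ Z,
            x * y⁻¹ * y' * z⁻¹ = x' * z'⁻¹ → x = x' ∧ y = y' ∧ z = z') ∧
          (q : ℝ) ^ ((n : ℝ) ^ 2 / 2 - ε * n) ≤ (X.card : ℝ) ∧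
          (q : ℝ) ^ ((n : ℝ) ^ 2 / 2 - ε * n) ≤ (Y.card : ℝ) ∧
          (q : ℝ) ^ ((n : ℝ) ^ 2 / 2 - ε * n) ≤ (Z.card : ℝ) ∧
          (∀ x₀ ∈ X, ∀ z₀ ∈ Z, ∃ p : MvPolynomial (Fin n × Fin n) ℂ,
            (p.totalDegree : ℝ) ≤ (q : ℝ) ^ (1 + δ) ∧
            ∀ x ∈ X, ∀ y ∈ Y, ∀ y' ∈ Y, ∀ z ∈ Z,
              ((x = x₀ ∧ y = y' ∧ z = z₀) → ‖MvPolynomial.eval (pt x y y' z) p - 1‖ ≤ η) ∧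
              (¬ (x = x₀ ∧ y = y' ∧ z = z₀) → ‖MvPolynomial.eval (pt x y y' z) p‖ ≤ η)) ∧
          ∃ m : ℕ, 2 * m + n ≤ n ^ 2 ∧
            ∃ (A₀ : Matrix (Fin n) (Fin n) ℂ) (A : Fin m → Matrix (Fin n) (Fin n) ℂ),
              ∀ y ∈ Y, ∃ t : Fin m → ℂ, (y : Matrix (Fin n) (Fin n) ℂ) = A₀ + ∑ k, t k • A k) := by
  intro H
  obtain ⟨n, hn3, Hn⟩ := H (1 / 8) (by norm_num)
  have hn : (3 : ℝ) ≤ n := by exact_mod_cast hn3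
  have hnpos : (0 : ℝ) < n := by linarith
  have Hδ := Hn (1 / (4 * n)) (by positivity)
  obtain ⟨q₀, hq₀⟩ := counting_real_core (a := (n : ℝ) ^ 2 / 2 - 1 / 8 * n) (b := 1 + 1 / (4 * n))
    (μ := ((n : ℝ) ^ 2 - n) / 2) (by positivity) (by
      have e : (1 + 1 / (4 * n)) * (((n : ℝ) ^ 2 - n) / 2)
          = ((n : ℝ) ^ 2 - n) / 2 + (n - 1) / 8 := by field_simp; ring
      rw [e]; nlinarith)
  obtain ⟨q, hq, Hq⟩ := Hδ (max q₀ 1)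
  have hq1 : (1 : ℝ) ≤ q := by exact_mod_cast le_trans (le_max_right q₀ 1) hq
  have hq0 : (0 : ℝ) < q := by linarith
  set a : ℝ := (n : ℝ) ^ 2 / 2 - 1 / 8 * n with ha
  set N : ℕ := ⌈(q : ℝ) ^ a⌉₊ with hN
  set s : ℕ := ⌊(q : ℝ) ^ ((1 : ℝ) + 1 / (4 * n))⌋₊ with hs
  have hqa : (0 : ℝ) < (q : ℝ) ^ a := Real.rpow_pos_of_pos hq0 a
  set η : ℝ := 1 / (2 * ((N : ℝ) + 1)) with hη
  have hηpos : 0 < η := by rw [hη]; positivity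
  obtain ⟨X, Y, Z, -, hX, hY, hZ, hsep, m, hm, A₀, A, hYaff⟩ := Hq η hηpos
  have hNY : N ≤ Y.card := Nat.ceil_le.mpr hY
  have hXne : X.Nonempty := by
    rw [← Finset.card_pos]
    have : (0 : ℝ) < X.card := lt_of_lt_of_le (Real.rpow_pos_of_pos hq0 _) hX
    exact_mod_cast this
  have hZne : Z.Nonempty := by
    rw [← Finset.card_pos]
    have : (0 : ℝ) < Z.card := lt_of_lt_of_le (Real.rpow_pos_of_pos hq0 _) hZ
    exact_mod_cast this
  obtain ⟨Y', hY'Y, hY'card⟩ := Finset.exists_subset_card_eq hNY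
  have hsep' : ∀ x₀ ∈ X, ∀ z₀ ∈ Z, ∃ p : MvPolynomial (Fin n × Fin n) ℂ, p.totalDegree ≤ s ∧
      ∀ x ∈ X, ∀ y ∈ Y', ∀ y' ∈ Y', ∀ z ∈ Z,
        ((x = x₀ ∧ y = y' ∧ z = z₀) → ‖MvPolynomial.eval (pt x y y' z) p - 1‖ ≤ η) ∧
        (¬ (x = x₀ ∧ y = y' ∧ z = z₀) → ‖MvPolynomial.eval (pt x y y' z) p‖ ≤ η) := by
    intro x₀ hx₀ z₀ hz₀
    obtain ⟨p, hpdeg, hp⟩ := hsep x₀ hx₀ z₀ hz₀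
    exact ⟨p, Nat.le_floor hpdeg,
      fun x hx y hy y' hy' z hz => hp x hx y (hY'Y hy) y' (hY'Y hy') z hz⟩
  have hηN : η * Y'.card < 1 := by
    rw [hY'card, hη, div_mul_eq_mul_div, one_mul, div_lt_one (by positivity)]
    linarith
  have hbound := card_Y_le_of_separators_affine hXne hZne hsep' hηN A₀ A
    (fun y hy => hYaff y (hY'Y hy))
  rw [hY'card] at hbound
  have hmμ : (m : ℝ) ≤ ((n : ℝ) ^ 2 - n) / 2 := by
    have : ((2 * m + n : ℕ) : ℝ) ≤ ((n ^ 2 : ℕ) : ℝ) := by exact_mod_cast hm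
    push_cast at this
    linarith
  exact hq₀ q (le_trans (le_max_left _ _) hq) N s m hmμ (Nat.le_ceil _)
    (Nat.floor_le (by positivity)) hbound

/-- **No half-dimensional border designs with `Z⁻¹` in an affine subspace of dimension `≤ (n²−n)/2`**
(`Z` inside a translate of the unitriangular group, a torus, a vector group …).  Same counting, through
`card_Z_le_of_separators_affineInv`. [folklore] -/
theorem not_borderHalfDimensionDesigns_affineZinv :
    ¬ (∀ ε : ℝ, 0 < ε → ∃ n : ℕ, 3 ≤ n ∧ ∀ δ : ℝ, 0 < δ → ∀ q₀ : ℕ, ∃ q : ℕ, q₀ ≤ q ∧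
        ∀ η : ℝ, 0 < η → ∃ X Y Z : Finset (Matrix.GeneralLinearGroup (Fin n) ℂ), (∀ x ∈ X, ∀ x' ∈ X, ∀ y ∈ Y, ∀ y' ∈ Y, ∀ z ∈ Z, ∀ z' ∈ Z,
            x * y⁻¹ * y' * z⁻¹ = x' * z'⁻¹ → x = x' ∧ y = y' ∧ z = z') ∧
          (q : ℝ) ^ ((n : ℝ) ^ 2 / 2 - ε * n) ≤ (X.card : ℝ) ∧
          (q : ℝ) ^ ((n : ℝ) ^ 2 / 2 - ε * n) ≤ (Y.card : ℝ) ∧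
          (q : ℝ) ^ ((n : ℝ) ^ 2 / 2 - ε * n) ≤ (Z.card : ℝ) ∧
          (∀ x₀ ∈ X, ∀ z₀ ∈ Z, ∃ p : MvPolynomial (Fin n × Fin n) ℂ,
            (p.totalDegree : ℝ) ≤ (q : ℝ) ^ (1 + δ) ∧
            ∀ x ∈ X, ∀ y ∈ Y, ∀ y' ∈ Y, ∀ z ∈ Z,
              ((x = x₀ ∧ y = y' ∧ z = z₀) → ‖MvPolynomial.eval (pt x y y' z) p - 1‖ ≤ η) ∧
              (¬ (x = x₀ ∧ y = y' ∧ z = z₀) → ‖MvPolynomial.eval (pt x y y' z) p‖ ≤ η)) ∧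
          ∃ m : ℕ, 2 * m + n ≤ n ^ 2 ∧
            ∃ (A₀ : Matrix (Fin n) (Fin n) ℂ) (A : Fin m → Matrix (Fin n) (Fin n) ℂ),
              ∀ z ∈ Z, ∃ t : Fin m → ℂ, ((z⁻¹ : Matrix.GeneralLinearGroup (Fin n) ℂ) : Matrix (Fin n) (Fin n) ℂ) = A₀ + ∑ k, t k • A k) := by
  intro H
  obtain ⟨n, hn3, Hn⟩ := H (1 / 8) (by norm_num)
  have hn : (3 : ℝ) ≤ n := by exact_mod_cast hn3
  have hnpos : (0 : ℝ) < n := by linarith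
  have Hδ := Hn (1 / (4 * n)) (by positivity)
  obtain ⟨q₀, hq₀⟩ := counting_real_core (a := (n : ℝ) ^ 2 / 2 - 1 / 8 * n) (b := 1 + 1 / (4 * n))
    (μ := ((n : ℝ) ^ 2 - n) / 2) (by positivity) (by
      have e : (1 + 1 / (4 * n)) * (((n : ℝ) ^ 2 - n) / 2)
          = ((n : ℝ) ^ 2 - n) / 2 + (n - 1) / 8 := by field_simp; ring
      rw [e]; nlinarith)
  obtain ⟨q, hq, Hq⟩ := Hδ (max q₀ 1)
  have hq1 : (1 : ℝ) ≤ q := by exact_mod_cast le_trans (le_max_right q₀ 1) hq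
  have hq0 : (0 : ℝ) < q := by linarith
  set a : ℝ := (n : ℝ) ^ 2 / 2 - 1 / 8 * n with ha
  set N : ℕ := ⌈(q : ℝ) ^ a⌉₊ with hN
  set s : ℕ := ⌊(q : ℝ) ^ ((1 : ℝ) + 1 / (4 * n))⌋₊ with hs
  have hqa : (0 : ℝ) < (q : ℝ) ^ a := Real.rpow_pos_of_pos hq0 a
  set η : ℝ := 1 / (2 * ((N : ℝ) + 1)) with hη
  have hηpos : 0 < η := by rw [hη]; positivity
  obtain ⟨X, Y, Z, -, hX, hY, hZ, hsep, m, hm, A₀, A, hZaff⟩ := Hq η hηpos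
  have hNZ : N ≤ Z.card := Nat.ceil_le.mpr hZ
  have hXne : X.Nonempty := by
    rw [← Finset.card_pos]
    have : (0 : ℝ) < X.card := lt_of_lt_of_le (Real.rpow_pos_of_pos hq0 _) hX
    exact_mod_cast this
  have hYne : Y.Nonempty := by
    rw [← Finset.card_pos]
    have : (0 : ℝ) < Y.card := lt_of_lt_of_le (Real.rpow_pos_of_pos hq0 _) hY
    exact_mod_cast this
  obtain ⟨Z', hZ'Z, hZ'card⟩ := Finset.exists_subset_card_eq hNZ
  have hsep' : ∀ x₀ ∈ X, ∀ z₀ ∈ Z', ∃ p : MvPolynomial (Fin n × Fin n) ℂ, p.totalDegree ≤ s ∧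
      ∀ x ∈ X, ∀ y ∈ Y, ∀ y' ∈ Y, ∀ z ∈ Z',
        ((x = x₀ ∧ y = y' ∧ z = z₀) → ‖MvPolynomial.eval (pt x y y' z) p - 1‖ ≤ η) ∧
        (¬ (x = x₀ ∧ y = y' ∧ z = z₀) → ‖MvPolynomial.eval (pt x y y' z) p‖ ≤ η) := by
    intro x₀ hx₀ z₀ hz₀
    obtain ⟨p, hpdeg, hp⟩ := hsep x₀ hx₀ z₀ (hZ'Z hz₀)
    exact ⟨p, Nat.le_floor hpdeg,
      fun x hx y hy y' hy' z hz => hp x hx y hy y' hy' z (hZ'Z hz)⟩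
  have hηN : η * Z'.card < 1 := by
    rw [hZ'card, hη, div_mul_eq_mul_div, one_mul, div_lt_one (by positivity)]
    linarith
  have hbound := card_Z_le_of_separators_affineInv hXne hYne hsep' hηN A₀ A
    (fun z hz => hZaff z (hZ'Z hz))
  rw [hZ'card] at hbound
  have hmμ : (m : ℝ) ≤ ((n : ℝ) ^ 2 - n) / 2 := by
    have : ((2 * m + n : ℕ) : ℝ) ≤ ((n ^ 2 : ℕ) : ℝ) := by exact_mod_cast hm
    push_cast at this
    linarith
  exact hq₀ q (le_trans (le_max_left _ _) hq) N s m hmμ (Nat.le_ceil _)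
    (Nat.floor_le (by positivity)) hbound

end BorderHalfDimensionDesignsNeg

end Summit.MatrixMultiplication.MatrixMultiplication.Theorems
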